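import Literature.Computability.Complexity.SharpSATMembership
import Literature.Computability.Complexity.FPStringBricks

-- every `Summit.PneNP.PneNP.…` name repeats the summit = sub-problem component (layout D-0017)
set_option linter.dupNamespace false

/-!
# A polynomial-time test "the bit string `y` satisfies the coded CNF" (support of `CalibrationSatBPP`)

Helper file for the support item `CalibrationSatBPP` (stmt-PneNP-2437) of route
`PneNP/WitnessForging`: the calibration `SAT ∉ BPP → ForgingThesis` runs a witness forger `A` on the
code of a CNF `φ` and ACCEPTS iff the output string `y` satisfies `φ` under the assignment
`xᵢ ↦ y.getD i false` of the thesis. This file supplies that acceptance test as a string function in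
`FP`, assembled (no machine is written, no definition is introduced) from the tree's brick algebra:
on `⟨encode φ, y⟩` it is the `allFn`/`anyFn` scan (`ListFoldBricks.lean`) of the clause and literal
codes (`encodingCNF`: `⟨1ᵐ, ⟨clause codes⟩⟩`, clause `⟨1ᵏ, ⟨literal codes⟩⟩`, literal
`⟨bin v, [b]⟩`, `SharpSATMembership.lean`) with the literal test "`v < |y|` and `y[v] = b`", read off
`y` by `binToUnaryFn` (bounded binary-to-unary conversion, ruler `y`) and `bitAtFn`
(`FPStringBricks.lean`). The test is the STRICT one — a literal on a variable `≥ |y|` counts as false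
— which is sound for satisfiability and agrees with `CNF.eval` on strings of length `numVars φ`.

Main result: `exists_satTestFn` — there is a one-bit `V ∈ FP` with
`V ⟨encode φ, y⟩ = [∀ c ∈ φ, ∃ l ∈ c, l.1 < |y| ∧ y.getD l.1 false = l.2]`; and the two readings
`eval_of_strictSat` / `strictSat_of_eval`.

## References

* S. Arora, B. Barak, *Computational Complexity: A Modern Approach*, CUP 2009, §1.3 (polynomial
  time is closed under composition and bounded loops), §0.1 (codes of lists), Def. 2.9 (CNF).
* O. Goldreich, *Foundations of Cryptography I*, CUP 2001, §2.7.3 (`NP ∖ BPP ≠ ∅` as the floor of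
  average-case hardness; the verified output of a probabilistic search is a one-sided test).
-/

namespace Summit.PneNP.PneNP.Theorems.CalibrationSatBPP

open Literature.Computability.Complexity _root_.Computability Brick

/-- The literal test on `⟨y, ⟨bin v, [b]⟩⟩`: `[(y.drop (min v |y|)).take 1 = [b]]`, i.e.
`[v < |y| ∧ y[v] = b]` (binary-to-unary conversion of `v` capped by the ruler `y`, then the bit of `y`
at that unary position, compared with `[b]`). [folklore] -/
theorem litTest_boolPair (y : List Bool) (l : Literal ℕ) :
    (eqPairFn ∘ fanoutFn (bitAtFn ∘ fanoutFn (binToUnaryFn ∘ fanoutFn fstF (fstF ∘ sndF)) fstF)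
        (sndF ∘ sndF)) (boolPair y (encodingLiteral.encode l)) =
      [decide (l.1 < y.length ∧ y.getD l.1 false = l.2)] := by
  rw [SharpSATVerif.encode_literal]
  simp only [Function.comp_apply, fanoutFn_apply, fstF_boolPair, sndF_boolPair,
    binToUnaryFn_boolPair, bitsToNat_encodeNat, bitAtFn_boolPair, eqPairFn_boolPair,
    List.length_replicate]
  congr 1
  by_cases h : l.1 < y.length
  · rw [min_eq_left h.le, List.take_one_drop_eq_of_lt_length h, List.getD_eq_getElem _ _ h]
    simp [h]
  · rw [min_eq_right (not_lt.1 h), List.drop_length]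
    simp [h]

/-- The literal test is one-bit. [folklore] -/
theorem oneBit_litTest :
    OneBit (eqPairFn ∘ fanoutFn (bitAtFn ∘ fanoutFn (binToUnaryFn ∘ fanoutFn fstF (fstF ∘ sndF)) fstF)
        (sndF ∘ sndF)) := fun z => by
  simp only [Function.comp_apply, fanoutFn_apply, eqPairFn_boolPair]
  exact ⟨_, rfl⟩

/-- The literal test is in `FP`. [cite: AroraBarakCC2009, §1.3] -/
theorem litTest_mem_FP :
    (eqPairFn ∘ fanoutFn (bitAtFn ∘ fanoutFn (binToUnaryFn ∘ fanoutFn fstF (fstF ∘ sndF)) fstF)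
        (sndF ∘ sndF)) ∈ FP :=
  comp_mem_FP eqPairFn_mem_FP (fanoutFn_mem_FP
    (comp_mem_FP bitAtFn_mem_FP (fanoutFn_mem_FP
      (comp_mem_FP binToUnaryFn_mem_FP (fanoutFn_mem_FP fstF_mem_FP (comp_mem_FP fstF_mem_FP sndF_mem_FP)))
      fstF_mem_FP))
    (comp_mem_FP sndF_mem_FP sndF_mem_FP))

/-- The clause test on `⟨y, encode c⟩`: some literal of `c` passes the literal test. [folklore] -/
theorem clauseTest_boolPair (y : List Bool) (c : Clause ℕ) :
    (anyFn (eqPairFn ∘ fanoutFn (bitAtFn ∘ fanoutFn (binToUnaryFn ∘ fanoutFn fstF (fstF ∘ sndF)) fstF)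
        (sndF ∘ sndF)) ∘ fanoutFn fstF (sndF ∘ sndF)) (boolPair y (encodingClause.encode c)) =
      [decide (∃ l ∈ c, l.1 < y.length ∧ y.getD l.1 false = l.2)] := by
  rw [Function.comp_apply, fanoutFn_apply, fstF_boolPair, Function.comp_apply, sndF_boolPair,
    SharpSATVerif.encode_clause, sndF_boolPair, anyFn_boolPair oneBit_litTest, decNil_encList]
  congr 1
  refine decide_eq_decide.mpr ⟨?_, ?_⟩
  · rintro ⟨a, ha, h⟩
    obtain ⟨l, hl, rfl⟩ := List.mem_map.1 ha
    rw [litTest_boolPair] at h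
    exact ⟨l, hl, of_decide_eq_true (List.cons.inj h).1⟩
  · rintro ⟨l, hl, h⟩
    refine ⟨_, List.mem_map.2 ⟨l, hl, rfl⟩, ?_⟩
    rw [litTest_boolPair, decide_eq_true h]

/-- **The strict satisfaction test is in `FP`**: a one-bit `V ∈ FP` with
`V ⟨encode φ, y⟩ = [∀ c ∈ φ, ∃ l ∈ c, l.1 < |y| ∧ y.getD l.1 false = l.2]` — every clause has a literal
whose variable is a position of `y` carrying the literal's polarity. It is
`allFn (anyFn litTest ∘ ⟨fstF, sndF ∘ sndF⟩) ∘ ⟨sndF, sndF ∘ fstF⟩`: from `⟨encode φ, y⟩` pass to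
`⟨y, clause codes⟩`, and for each clause code `⟨1ᵏ, literal codes⟩` to `⟨y, literal codes⟩`.
[cite: AroraBarakCC2009, §1.3 (bounded loops)] -/
theorem exists_satTestFn :
    ∃ V : List Bool → List Bool, V ∈ FP ∧ OneBit V ∧
      ∀ (φ : CNF ℕ) (y : List Bool), V (boolPair (encodingCNF.encode φ) y) =
        [decide (∀ c ∈ φ, ∃ l ∈ c, l.1 < y.length ∧ y.getD l.1 false = l.2)] := by
  have h1cl : OneBit (anyFn (eqPairFn ∘ fanoutFn (bitAtFn ∘ fanoutFn (binToUnaryFn ∘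
      fanoutFn fstF (fstF ∘ sndF)) fstF) (sndF ∘ sndF)) ∘ fanoutFn fstF (sndF ∘ sndF)) :=
    (oneBit_anyFn oneBit_litTest).comp _
  refine ⟨allFn (anyFn (eqPairFn ∘ fanoutFn (bitAtFn ∘ fanoutFn (binToUnaryFn ∘
      fanoutFn fstF (fstF ∘ sndF)) fstF) (sndF ∘ sndF)) ∘ fanoutFn fstF (sndF ∘ sndF)) ∘
      fanoutFn sndF (sndF ∘ fstF), ?_, (oneBit_allFn h1cl).comp _, fun φ y => ?_⟩
  · exact comp_mem_FP (allFn_mem_FP (comp_mem_FP (anyFn_mem_FP litTest_mem_FP oneBit_litTest)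
      (fanoutFn_mem_FP fstF_mem_FP (comp_mem_FP sndF_mem_FP sndF_mem_FP))) h1cl)
      (fanoutFn_mem_FP sndF_mem_FP (comp_mem_FP sndF_mem_FP fstF_mem_FP))
  · rw [Function.comp_apply, fanoutFn_apply, sndF_boolPair, Function.comp_apply, fstF_boolPair,
      SharpSATVerif.encode_cnf, sndF_boolPair, allFn_boolPair h1cl, decNil_encList]
    congr 1
    refine decide_eq_decide.mpr ⟨fun h c hc => ?_, fun h a ha => ?_⟩
    · have := h _ (List.mem_map.2 ⟨c, hc, rfl⟩)
      rw [clauseTest_boolPair] at this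
      exact of_decide_eq_true (List.cons.inj this).1
    · obtain ⟨c, hc, rfl⟩ := List.mem_map.1 ha
      rw [clauseTest_boolPair, decide_eq_true (h c hc)]

/-- **Soundness of the strict test**: if every clause has a literal `(v, b)` with `v < |y|` and
`y.getD v false = b`, then `φ` is true under the thesis's assignment `i ↦ y.getD i false`.
[cite: AroraBarakCC2009, Def. 2.9] -/
theorem eval_of_strictSat {φ : CNF ℕ} {y : List Bool}
    (h : ∀ c ∈ φ, ∃ l ∈ c, l.1 < y.length ∧ y.getD l.1 false = l.2) :
    φ.eval (fun i => y.getD i false) = true := by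
  rw [CNF.eval_eq_true_iff]
  intro c hc
  obtain ⟨l, hl, -, hlv⟩ := h c hc
  unfold Clause.eval
  rw [List.any_eq_true]
  exact ⟨l, hl, by simp only [Literal.eval, hlv, beq_self_eq_true]⟩

/-- **Completeness of the strict test on full-length strings**: if `φ` is true under `i ↦ y.getD i false`
and every occurring variable is `< |y|` (e.g. `|y| = numVars φ`), the strict test accepts.
[cite: AroraBarakCC2009, Def. 2.9] -/
theorem strictSat_of_eval {φ : CNF ℕ} {y : List Bool} (hlen : ∀ c ∈ φ, ∀ l ∈ c, l.1 < y.length)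
    (h : φ.eval (fun i => y.getD i false) = true) :
    ∀ c ∈ φ, ∃ l ∈ c, l.1 < y.length ∧ y.getD l.1 false = l.2 := by
  rw [CNF.eval_eq_true_iff] at h
  intro c hc
  have hc' := h c hc
  unfold Clause.eval at hc'
  obtain ⟨l, hl, hlv⟩ := List.any_eq_true.1 hc'
  refine ⟨l, hl, hlen c hc l hl, ?_⟩
  simpa [Literal.eval] using hlv

end Summit.PneNP.PneNP.Theorems.CalibrationSatBPP
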